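import Mathlib
import Summits.Langlands.Langlands.Theorems.PhantomRMYoshidaStableYoshidaCongruenceSwitchToModularSurface
import Summits.Langlands.Langlands.Theorems.PhantomRMYoshidaStableYoshidaCongruenceModelFpDichotomy
import Literature.RepresentationTheory.Semisimple.OddDescentFinTwo
import HarnessLib

/-!
# Route `PhantomRMYoshida`, crux `StableYoshidaCongruence` (stmt-Langlands-13640), line
# `burkhardt-weddle-two-three-anchor`: Stub 1 `stub_modelFp` — the `𝔽_p`-model of an `𝔽_p`-rational pair

`k` algebraically closed of characteristic `p` with the DISCRETE topology, `σ, σ' : Γ_ℚ → GL₂(k)`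
continuous and irreducible, and every `det(X - σ(g)) · det(X - σ'(g))` the image of a polynomial over
`𝔽_p`.  Then there is a continuous `ρb : Γ_ℚ → GL₄(𝔽_p)` with `ρb ⊗ k` conjugate in `GL₄(k)` to the block
sum `σ ⊕ σ'` (LTWS `IsModelOf`), i.e. `σ ⊕ σ'` has an `𝔽_p`-MODEL (`stub_modelFp`, the registered
signature of the checked skeleton `Cruxes/StableYoshidaCongruence/Lines/burkhardt_weddle_two_three_anchor`).

Proof (Schur indices over finite fields are `1`: Deligne–Serre 1974, Lemme 6.13; here for `n = 2` twice).
By the Frobenius dichotomy (part II, `ModelFp.frobenius_dichotomy`) either both constituents are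
`F`-invariant — Case A, `ModelFp.exists_model_of_frobenius_fixed` (part II) — or `F` SWAPS them,
`F(det(X - σ)) = det(X - σ')`, the phantom-RM pair `σ' ≃ σ^(p)`.  Case B is this file's
`ModelFp.exists_model_of_frobenius_swap`: the `det(X - σ(g))` are `F²`-invariant, hence come from
`𝔽_{p²} = GaloisField p 2 ↪ k`; descend `σ` to `ρ₂ : Γ_ℚ → GL₂(𝔽_{p²})` (tree `exists_descent_fin_two`);
RESTRICTION OF SCALARS `Res_{𝔽_{p²}/𝔽_p} ρ₂` is made explicit as a Galois descent: for `ψ = ρ₂ ⊗ k` the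
block sum `D = ψ ⊕ ψ^F` has `F(D) = S D S` (`S` the block swap, as `F²` fixes `𝔽_{p²}`), and for
`β ∈ 𝔽_{p²} ∖ 𝔽_p` the invertible `T = (-β^p, -β; 1, 1) ⊗ 1₂` has `F(T) = T S`, so `T D T⁻¹` is
entrywise `F`-fixed, i.e. comes from `GL₄(𝔽_p)` (tree `exists_glHom_lift`); it is continuous (kernel
`⊇ ker σ`, open) and its base change `T D T⁻¹` is conjugate to `D`, which is conjugate to `σ ⊕ σ'` by
Brauer–Nesbitt (part I, `ModelFp.exists_conj_blockDiag`: `ψ`, `ψ^F` have the characteristic polynomials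
of the irreducible `σ`, `σ'`).

Everything used is proved in the tree (parts I–II of this stub, `FiniteFieldDescentAbsIrred`,
`OddDescentFinTwo`, `BrauerNesbitt`, `Semisimplification`, the LTWS Stub-2 module for `IsModelOf`); no named
fact is taken as a hypothesis.  Worker of lead prover-line-stmt-Langlands-13640-c1-0 (2026-08-16).
-/

-- `Summit.Langlands.Langlands.…` (summit = sub-problem name, D-0017 layout) trips `dupNamespace` on every decl.
set_option linter.dupNamespace false

noncomputable section

open Polynomial Matrix
open Literature.NumberTheory.GaloisRepresentations
open Literature.RepresentationTheory.Semisimple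
open Summit.Langlands.Langlands.Cruxes.StableYoshidaCongruence.LevelThreeWeierstrassSwitch

namespace Summit.Langlands.Langlands.Cruxes.StableYoshidaCongruence.BurkhardtWeddleTwoThreeAnchor

namespace ModelFp

variable {k : Type} [Field k] {G : Type} [Group G]

section CaseB

variable {p : ℕ} [Fact p.Prime] [CharP k p] [TopologicalSpace k] [DiscreteTopology k]
  [TopologicalSpace G] [IsTopologicalGroup G]

omit [Fact p.Prime] [CharP k p] [TopologicalSpace k] [DiscreteTopology k] [TopologicalSpace G]
  [IsTopologicalGroup G] in
/-- Congruence for reindexed block matrices with scalar blocks. [folklore] -/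
theorem reindex_fromBlocks_smul_one_congr {m n : ℕ} (e : Fin m ⊕ Fin m ≃ Fin n)
    {a b c d a' b' c' d' : k} (ha : a = a') (hb : b = b') (hc : c = c') (hd : d = d') :
    Matrix.reindex e e (Matrix.fromBlocks (a • (1 : Matrix (Fin m) (Fin m) k))
        (b • (1 : Matrix (Fin m) (Fin m) k)) (c • (1 : Matrix (Fin m) (Fin m) k))
        (d • (1 : Matrix (Fin m) (Fin m) k))) =
      Matrix.reindex e e (Matrix.fromBlocks (a' • (1 : Matrix (Fin m) (Fin m) k))
        (b' • (1 : Matrix (Fin m) (Fin m) k)) (c' • (1 : Matrix (Fin m) (Fin m) k))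
        (d' • (1 : Matrix (Fin m) (Fin m) k))) := by
  subst ha hb hc hd
  rfl

/-- **Case B of the descent (the phantom-RM pair).**  If `σ, σ' : G → GL₂(k)` are continuous
(`k` algebraically closed of characteristic `p`, discrete), irreducible, and the Frobenius `F` SWAPS
their characteristic polynomials (`F(det(X - σ(g))) = det(X - σ'(g))` and vice versa), then there is a
continuous `ρb : G → GL₄(𝔽_p)` with `ρb ⊗ k` conjugate to `σ ⊕ σ'`.  Proof: the `det(X - σ(g))` are
`F²`-invariant, i.e. lie in `𝔽_{p²}[X]` for the field `𝔽_{p²} = GaloisField p 2 ↪ k`; descend `σ` to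
`ρ₂ : G → GL₂(𝔽_{p²})` (Deligne–Serre 6.13 for `n = 2`, tree `exists_descent_fin_two`); for
`ψ = ρ₂ ⊗ k` the block sum `D = ψ ⊕ ψ^F` satisfies `F(D) = S D S` (`S` the block swap), and for
`β ∈ 𝔽_{p²} ∖ 𝔽_p` the matrix `T = (-β^p, -β; 1, 1) ⊗ 1₂` satisfies `F(T) = T S`, so `T D T⁻¹` is
`F`-invariant, i.e. `𝔽_p`-valued (tree `exists_glHom_lift`): this is restriction of scalars
`Res_{𝔽_{p²}/𝔽_p} ρ₂` made explicit.  Finally `D` is conjugate to `σ ⊕ σ'` (`exists_conj_blockDiag`: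
`det(X - ψ^F(g)) = F(det(X - σ(g))) = det(X - σ'(g))`).
[cite: DeligneSerreASENS1974, Lemme 6.13] -/
theorem exists_model_of_frobenius_swap [IsAlgClosed k] (σ σ' : FramedRep G k 2)
    (hσ : σ.IsIrreducible) (hσ' : σ'.IsIrreducible)
    (h : ∀ g, (FramedRep.charpoly σ g).map (frobenius k p) = FramedRep.charpoly σ' g)
    (h' : ∀ g, (FramedRep.charpoly σ' g).map (frobenius k p) = FramedRep.charpoly σ g) :
    ∃ (ρb : FramedRep G (ZMod p) 4) (P : GL (Fin 4) k), ∀ g,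
      ((P⁻¹ * FramedRep.baseChange (ZMod.castHom (dvd_refl p) k) continuous_of_discreteTopology ρb g *
          P : GL (Fin 4) k) : Matrix (Fin 4) (Fin 4) k) =
        Matrix.reindex finSumFinEquiv finSumFinEquiv
          (Matrix.fromBlocks ((σ g : GL (Fin 2) k) : Matrix (Fin 2) (Fin 2) k) 0 0
            ((σ' g : GL (Fin 2) k) : Matrix (Fin 2) (Fin 2) k)) := by
  classical
  set c := ZMod.castHom (dvd_refl p) k with hcdef
  set F := frobenius k p with hFdef
  have hp1 : 1 < p := (Fact.out : p.Prime).one_lt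
  -- ### the field with `p²` elements inside `k`
  letI : Algebra (ZMod p) k := ZMod.algebra k p
  letI : Fintype (GaloisField p 2) := Fintype.ofFinite (GaloisField p 2)
  have hcard : Fintype.card (GaloisField p 2) = p ^ 2 := by
    rw [← Nat.card_eq_fintype_card]
    exact GaloisField.card p 2 two_ne_zero
  let jₐ : GaloisField p 2 →ₐ[ZMod p] k := IsAlgClosed.lift
  set j : GaloisField p 2 →+* k := jₐ.toRingHom with hjdef
  have hFFj : ∀ x : GaloisField p 2, F (F (j x)) = j x := by
    intro x
    rw [hFdef, frobenius_def, frobenius_def, ← pow_mul, ← sq, ← hcard, ← map_pow,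
      FiniteField.pow_card]
  -- ### descent of `σ` to `GL₂(𝔽_{p²})`
  have hcoeff : ∀ g n, (FramedRep.charpoly σ g).coeff n ^ Fintype.card (GaloisField p 2) =
      (FramedRep.charpoly σ g).coeff n := by
    intro g n
    have h2 : ((FramedRep.charpoly σ g).map F).map F = FramedRep.charpoly σ g := by rw [h g, h' g]
    have h3 := congrArg (fun P : k[X] => P.coeff n) h2
    simp only [Polynomial.coeff_map] at h3
    rw [hcard, sq, pow_mul, ← frobenius_def, ← frobenius_def (p := p)]
    exact h3
  have hQ : ∀ g, ∃ Q : (GaloisField p 2)[X], Q.map j =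
      ((σ.toMonoidHom g : GL (Fin 2) k) : Matrix (Fin 2) (Fin 2) k).charpoly := fun g =>
    exists_map_eq_of_coeff_pow_card j _ (hcoeff g)
  obtain ⟨ρ₂, hker, hchar⟩ := exists_descent_fin_two j σ.toMonoidHom hQ
  set ψ : G →* GL (Fin 2) k := (Matrix.GeneralLinearGroup.map j).comp ρ₂ with hψdef
  set ψF : G →* GL (Fin 2) k := (Matrix.GeneralLinearGroup.map F).comp ψ with hψFdef
  have hψ : ∀ g, ((ψ g : GL (Fin 2) k) : Matrix (Fin 2) (Fin 2) k).charpoly =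
      ((σ.toMonoidHom g : GL (Fin 2) k) : Matrix (Fin 2) (Fin 2) k).charpoly := by
    intro g
    rw [← hchar g, ← Matrix.charpoly_map]
    rfl
  have hψF : ∀ g, ((ψF g : GL (Fin 2) k) : Matrix (Fin 2) (Fin 2) k).charpoly =
      ((σ'.toMonoidHom g : GL (Fin 2) k) : Matrix (Fin 2) (Fin 2) k).charpoly := by
    intro g
    change ((((ψ g : GL (Fin 2) k) : Matrix (Fin 2) (Fin 2) k)).map F).charpoly = _
    rw [Matrix.charpoly_map, hψ]
    exact h g
  obtain ⟨D, hD⟩ := exists_blockDiag_hom (k := k) (finSumFinEquiv : Fin 2 ⊕ Fin 2 ≃ Fin 4) ψ ψF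
  -- ### an element `β ∈ 𝔽_{p²} ∖ 𝔽_p`
  obtain ⟨α, hα⟩ : ∃ α : GaloisField p 2, α ^ p ≠ α := by
    by_contra hall
    push Not at hall
    have hsurj : Function.Surjective (algebraMap (ZMod p) (GaloisField p 2)) := fun x =>
      (mem_range_iff_pow_card_eq (algebraMap (ZMod p) (GaloisField p 2)) x).mpr
        (by rw [ZMod.card]; exact hall x)
    have hle := Fintype.card_le_of_surjective _ hsurj
    rw [hcard, ZMod.card, sq] at hle
    have : p * p ≤ p * 1 := by simpa using hle
    have := Nat.le_of_mul_le_mul_left this (by omega)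
    omega
  set β : k := j α with hβdef
  have hβp : β ^ p ≠ β := by
    intro hh
    apply hα
    apply j.injective
    rw [map_pow]
    exact hh
  have hβpp : (β ^ p) ^ p = β := by
    have := hFFj α
    rwa [hFdef, frobenius_def, frobenius_def] at this
  have hd : β - β ^ p ≠ 0 := sub_ne_zero.mpr (Ne.symm hβp)
  -- ### the matrices `T` (change of frame) and `S` (block swap)
  set e4 : Fin 2 ⊕ Fin 2 ≃ Fin 4 := finSumFinEquiv with he4
  set Tm : Matrix (Fin 4) (Fin 4) k := Matrix.reindex e4 e4
    (Matrix.fromBlocks ((-(β ^ p)) • (1 : Matrix (Fin 2) (Fin 2) k)) ((-β) • (1 : Matrix (Fin 2) (Fin 2) k))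
      ((1 : k) • (1 : Matrix (Fin 2) (Fin 2) k)) ((1 : k) • (1 : Matrix (Fin 2) (Fin 2) k))) with hTm
  set Sm : Matrix (Fin 4) (Fin 4) k := Matrix.reindex e4 e4
    (Matrix.fromBlocks ((0 : k) • (1 : Matrix (Fin 2) (Fin 2) k)) ((1 : k) • (1 : Matrix (Fin 2) (Fin 2) k))
      ((1 : k) • (1 : Matrix (Fin 2) (Fin 2) k)) ((0 : k) • (1 : Matrix (Fin 2) (Fin 2) k))) with hSm
  have hmulR : ∀ M N : Matrix (Fin 2 ⊕ Fin 2) (Fin 2 ⊕ Fin 2) k,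
      Matrix.reindex e4 e4 M * Matrix.reindex e4 e4 N = Matrix.reindex e4 e4 (M * N) := fun M N => by
    rw [Matrix.reindex_apply, Matrix.reindex_apply, Matrix.reindex_apply]
    exact Matrix.submatrix_mul_equiv M N _ e4.symm _
  have hSS : Sm * Sm = 1 := by
    rw [hSm, hmulR, fromBlocks_smul_one_mul_fromBlocks_smul_one,
      reindex_fromBlocks_smul_one_congr e4 (a' := 1) (b' := 0) (c' := 0) (d' := 1) (by ring) (by ring)
        (by ring) (by ring), one_smul, zero_smul, Matrix.fromBlocks_one, Matrix.reindex_apply,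
      Matrix.submatrix_one_equiv]
  have hdet : Tm.det ≠ 0 := by
    rw [hTm, Matrix.det_reindex_self, one_smul, Matrix.det_fromBlocks_one₂₂, Matrix.mul_one, ← sub_smul,
      Matrix.det_smul, Matrix.det_one, mul_one, sub_neg_eq_add, Fintype.card_fin]
    exact pow_ne_zero _ (by rw [neg_add_eq_sub]; exact hd)
  have hTmF : Tm.map F = Tm * Sm := by
    have hblk : ∀ r : k, (r • (1 : Matrix (Fin 2) (Fin 2) k)).map F = F r • (1 : Matrix (Fin 2) (Fin 2) k) :=
      fun r => by rw [Matrix.map_smul' _ _ _ (map_mul F), Matrix.map_one F (map_zero F) (map_one F)]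
    rw [hTm, hSm, hmulR, fromBlocks_smul_one_mul_fromBlocks_smul_one, Matrix.reindex_apply,
      ← Matrix.submatrix_map]
    simp only [Matrix.fromBlocks_map, hblk]
    rw [← Matrix.reindex_apply]
    refine reindex_fromBlocks_smul_one_congr e4 ?_ ?_ ?_ ?_
    · rw [map_neg, hFdef, frobenius_def, hβpp]; ring
    · rw [map_neg, hFdef, frobenius_def]; ring
    · rw [map_one]; ring
    · rw [map_one]; ring
  have hDF : ∀ g, ((D g : GL (Fin 4) k) : Matrix (Fin 4) (Fin 4) k).map F =
      Sm * ((D g : GL (Fin 4) k) : Matrix (Fin 4) (Fin 4) k) * Sm := by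
    intro g
    have hX : (((ψF g : GL (Fin 2) k) : Matrix (Fin 2) (Fin 2) k)).map F =
        ((ψ g : GL (Fin 2) k) : Matrix (Fin 2) (Fin 2) k) := by
      have e1 : ((ψF g : GL (Fin 2) k) : Matrix (Fin 2) (Fin 2) k) =
          ((((ρ₂ g : GL (Fin 2) (GaloisField p 2)) : Matrix (Fin 2) (Fin 2) (GaloisField p 2)).map
            j).map F) := rfl
      have e2 : ((ψ g : GL (Fin 2) k) : Matrix (Fin 2) (Fin 2) k) =
          ((ρ₂ g : GL (Fin 2) (GaloisField p 2)) : Matrix (Fin 2) (Fin 2) (GaloisField p 2)).map j :=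
        rfl
      rw [e1, e2, Matrix.map_map, Matrix.map_map]
      congr 1
      funext x
      exact hFFj x
    have hY : (((ψ g : GL (Fin 2) k) : Matrix (Fin 2) (Fin 2) k)).map F =
        ((ψF g : GL (Fin 2) k) : Matrix (Fin 2) (Fin 2) k) := rfl
    rw [hD g, map_reindex_fromBlocks_zero, hX, hY, hSm, hmulR, hmulR]
    congr 1
    simp [Matrix.fromBlocks_multiply]
  -- ### the units `T`, `S` and the twisted conjugate `M = T D T⁻¹`
  set T : GL (Fin 4) k := Matrix.GeneralLinearGroup.mkOfDetNeZero Tm hdet with hTdef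
  let Su : GL (Fin 4) k := ⟨Sm, Sm, hSS, hSS⟩
  have hSu2 : Su * Su = 1 := Units.ext hSS
  have hFT : Matrix.GeneralLinearGroup.map F T = T * Su := Units.ext hTmF
  have hFD : ∀ g, Matrix.GeneralLinearGroup.map F (D g) = Su * D g * Su := fun g => Units.ext (hDF g)
  set Mh : G →* GL (Fin 4) k := (MulAut.conj T).toMonoidHom.comp D with hMhdef
  have hMh : ∀ g, Mh g = T * D g * T⁻¹ := fun g => rfl
  have hfix : ∀ g, Matrix.GeneralLinearGroup.map F (Mh g) = Mh g := by
    intro g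
    rw [hMh, map_mul, map_mul, map_inv, hFT, hFD, _root_.mul_inv_rev]
    calc T * Su * (Su * D g * Su) * (Su⁻¹ * T⁻¹)
        = T * (Su * Su) * D g * (Su * Su⁻¹) * T⁻¹ := by simp only [mul_assoc]
      _ = T * D g * T⁻¹ := by rw [hSu2, mul_inv_cancel, mul_one, mul_one]
  have hrange : ∀ g i l, ((Mh g : GL (Fin 4) k) : Matrix (Fin 4) (Fin 4) k) i l ∈ Set.range c := by
    intro g i l
    rw [mem_range_iff_pow_card_eq c, ZMod.card]
    have := congrArg (fun X : GL (Fin 4) k => (X : Matrix (Fin 4) (Fin 4) k) i l) (hfix g)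
    simpa [hFdef, frobenius_def] using this
  obtain ⟨ρ₀, hρ₀⟩ := exists_glHom_lift c Mh hrange
  -- ### continuity of the descended representation
  have hcont : Continuous ρ₀ := by
    refine continuous_of_ker_le σ σ ρ₀ fun g hg _ => ?_
    have h2 : ρ₂ g = 1 := hker (show σ.toMonoidHom g = 1 from hg)
    have hDg : D g = 1 := by
      refine Units.ext ?_
      rw [hD g]
      simp only [hψFdef, hψdef, MonoidHom.comp_apply, h2, map_one, Units.val_one, Matrix.fromBlocks_one,
        Matrix.reindex_apply, Matrix.submatrix_one_equiv]
    have hMg : Mh g = 1 := by rw [hMh, hDg, mul_one, mul_inv_cancel]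
    refine Units.ext (Matrix.map_injective c.injective ?_)
    change (((ρ₀ g : GL (Fin 4) (ZMod p)) : Matrix (Fin 4) (Fin 4) (ZMod p))).map c =
      ((1 : GL (Fin 4) (ZMod p)) : Matrix (Fin 4) (Fin 4) (ZMod p)).map c
    rw [hρ₀ g, hMg, Units.val_one, Units.val_one, Matrix.map_one c (map_zero c) (map_one c)]
  let ρb : FramedRep G (ZMod p) 4 := ⟨ρ₀, hcont⟩
  have hbc : ∀ g, FramedRep.baseChange c continuous_of_discreteTopology ρb g = Mh g := fun g =>
    Units.ext (hρ₀ g)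
  -- ### conjugate `D = ψ ⊕ ψ^F` to `σ ⊕ σ'`
  obtain ⟨Q, hQc⟩ := exists_conj_blockDiag σ.toMonoidHom σ'.toMonoidHom ψ ψF hσ hσ' hψ hψF D hD
  refine ⟨ρb, T * Q, fun g => ?_⟩
  have hgrp : (T * Q)⁻¹ * (T * D g * T⁻¹) * (T * Q) = Q⁻¹ * D g * Q := by group
  rw [hbc g, hMh, hgrp]
  exact hQc g

end CaseB

end ModelFp

/-! ## The stub -/

open ModelFp in
/-- **Stub 1 (`stub_modelFp`) — the `𝔽_p`-model of an `𝔽_p`-rational Yoshida pair.**  `k` algebraically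
closed of characteristic `p` (discrete), `σ, σ' : Γ_ℚ → GL₂(k)` continuous and IRREDUCIBLE, and every
`det(X - σ(g)) · det(X - σ'(g))` the image of a polynomial over `𝔽_p`.  Then `σ ⊕ σ'` has an
`𝔽_p`-MODEL: a continuous `ρb : Γ_ℚ → GL₄(𝔽_p)` with `ρb ⊗ k` conjugate to the block sum `σ ⊕ σ'` (LTWS
`IsModelOf`).  Proof: the Frobenius dichotomy (`ModelFp.frobenius_dichotomy`: Brauer–Nesbitt on `σ ⊕ σ'`
and its Frobenius twist, then Schur) gives either `F`-invariant constituents (Case A,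
`ModelFp.exists_model_of_frobenius_fixed`: descend both over `𝔽_p` by Deligne–Serre 6.13 for `n = 2`) or
the phantom-RM swap `F(det(X - σ)) = det(X - σ')` (Case B, `ModelFp.exists_model_of_frobenius_swap`:
descend `σ` over `𝔽_{p²}` and restrict scalars); in both cases the base change is conjugate to `σ ⊕ σ'`
by Brauer–Nesbitt (`ModelFp.exists_conj_blockDiag`).
[cite: DeligneSerreASENS1974, Lemme 6.13] -/
theorem stub_modelFp :
    ∀ (p : ℕ) [Fact p.Prime] (k : Type) [Field k] [CharP k p] [IsAlgClosed k]
      [TopologicalSpace k] [DiscreteTopology k] (σ σ' : FramedGaloisRep ℚ k 2),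
      σ.toGaloisRep.IsIrreducible → σ'.toGaloisRep.IsIrreducible →
      (∀ g : Field.absoluteGaloisGroup ℚ, ∃ Q : Polynomial (ZMod p),
        Q.map (ZMod.castHom (dvd_refl p) k) = FramedRep.charpoly σ g * FramedRep.charpoly σ' g) →
      ∃ ρb : FramedGaloisRep ℚ (ZMod p) 4, IsModelOf ρb σ σ' := by
  intro p _ k _ _ _ _ _ σ σ' hσ hσ' hQ
  have hσi : σ.IsIrreducible := hσ
  have hσ'i : σ'.IsIrreducible := hσ'
  have hcF : (frobenius k p).comp (ZMod.castHom (dvd_refl p) k) = ZMod.castHom (dvd_refl p) k :=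
    RingHom.ext fun x => by rw [RingHom.comp_apply, frobenius_def, ← map_pow, ZMod.pow_card]
  have hprod : ∀ g, (FramedRep.charpoly σ g * FramedRep.charpoly σ' g).map (frobenius k p) =
      FramedRep.charpoly σ g * FramedRep.charpoly σ' g := by
    intro g
    obtain ⟨Q, hQg⟩ := hQ g
    rw [← hQg, Polynomial.map_map, hcF]
  have hne : ∀ (τ : FramedGaloisRep ℚ k 2) g, FramedRep.charpoly τ g ≠ 0 := fun τ g =>
    (Matrix.charpoly_monic _).ne_zero
  rcases frobenius_dichotomy σ σ' hσi hσ'i hprod with hA | hB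
  · have hA' : ∀ g, (FramedRep.charpoly σ' g).map (frobenius k p) = FramedRep.charpoly σ' g := by
      intro g
      have h1 := hprod g
      rw [Polynomial.map_mul, hA g] at h1
      exact mul_left_cancel₀ (hne σ g) h1
    obtain ⟨ρb, P, hP⟩ := exists_model_of_frobenius_fixed σ σ' hσi hσ'i hA hA'
    exact ⟨ρb, P, hP⟩
  · have hB' : ∀ g, (FramedRep.charpoly σ' g).map (frobenius k p) = FramedRep.charpoly σ g := by
      intro g
      have h1 := hprod g
      rw [Polynomial.map_mul, hB g, mul_comm (FramedRep.charpoly σ g) (FramedRep.charpoly σ' g)] at h1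
      exact mul_left_cancel₀ (hne σ' g) h1
    obtain ⟨ρb, P, hP⟩ := exists_model_of_frobenius_swap σ σ' hσi hσ'i hB hB'
    exact ⟨ρb, P, hP⟩

end Summit.Langlands.Langlands.Cruxes.StableYoshidaCongruence.BurkhardtWeddleTwoThreeAnchor

end
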